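import Summits.Ventures.HSemireg.WedgePointPairPowersPerQOverlap

/-!
# Venture HSemireg — the kernel DIMENSION of `θ ↦ θ ∧ F` in EVERY degree for the `n`-fold box of `m`-dimensional point pairs
# (`C((m+m)n, k) − [t^k] P_m(t)ⁿ`), the volume degree `mn` (rank `1`), the dead degrees `k > mn` (rank `0`), curves and surfaces

HONEST FRAMING. Part of the Lean index of the computation cell `pub-hsemireg` (seat p10 gen 7, Sunday typer «UNIFORM-IN-n»).
Natural-number / integer POLYNOMIAL ARITHMETIC on top of the tree's rank theorems ONLY: no variety, no cohomology theory, no sheaf,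
no Ext group and no semiregularity map is constructed here; nothing here says that HC / HC_CM / HC_AV holds; no Literature fact is
declared or used.  Custodian versions cited: STRUCTURE.md v1.0-SIGNED 9b196a05977dd067 §1.1 C4 (`2n²`), C10 (`5n`); theory/FORMULA-N.md
PART A §2.2 (th-6: `P_n = 2(1+t)ⁿ − 1 − tⁿ`; «top-line collapse»; `P_1 = 1 + t`).

The tree has the RANK of `θ ↦ θ ∧ F` on `⋀^k K^{(m+m)n}` in every degree (`finrank_range_wedge_pairBox_eq_card` + `card_Kset`:
`= [t^k] P_m(t)ⁿ`, p10 gen 3/4) and the kernel DIMENSION only below the factor dimension (`WedgePointPairPowersKernelSpan`, `k < m`).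
THIS FILE (no new definition; rank–nullity and coefficient arithmetic) records, for every field, `m ≥ 1`, `n`, `a, c ≠ 0`:
* **`finrank_ker_wedge_pairBox_every_degree`**: `dim ker(θ ↦ θ ∧ F ∣ ⋀^k) = C((m+m)n, k) − [t^k] P_mⁿ` for EVERY `k` (in `ℤ[X]` with
  th-6's `P_m`: `…_cast`, via `coeff_pairPoly_pow_cast`);
* the VOLUME DEGREE `k = mn`: `[t^{mn}] P_mⁿ = ([t^m] P_m)ⁿ = 1` (`coeff_pairPoly_pow_self`), so **`finrank_range_wedge_pairBox_self`: rank 1**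
  (every degree-`mn` source maps to a multiple of the volume form) and `dim ker = C((m+m)n, mn) − 1`;
* the DEAD DEGREES `k > mn`: rank `0`, the kernel is all of `⋀^k` (`finrank_range_wedge_pairBox_eq_zero_of_lt`, `finrank_ker_… _of_lt`);
* the rank profile is PALINDROMIC: `reflect m P_m = P_m`, `[t^{mn−k}]P_mⁿ = [t^k]P_mⁿ`, **`finrank_range_wedge_pairBox_symm`**
  (`rank(⋀^{mn−k}) = rank(⋀^k)`; the per-`q` palindrome at fixed `k` is gen 4's `…PerQSymm`);
* CURVES (`m = 1`, `P_1 = 1 + t`): `rank = C(n,k)`, `dim ker = C(2n,k) − C(n,k)` (`finrank_ker_wedge_pairBox_one`);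
* SURFACES (`m = 2`) in degree 2: `dim ker = C(4n,2) − (8n² − 7n) = 5n` (`finrank_ker_wedge_pairBox_two_two`; STRUCTURE C10's `5n`, here in
  the `PairPowers` model — gen 2's `WedgeSurfacePowers.finrank_ker_surfaceBox_two` is the same number in the `Fin (4n)` surface model).
The NAMES of these kernels (split monomials, top-collapse binomials) are p10 gen 6/7's `WedgePointPairPowersKernelSpan` /
`…KernelCollapse`; this file is their dimension count, importable without them.  Namespace `Summit.Ventures.HSemireg.Wedge.PairPowers`.
-/

open Module Set Set.powersetCard Polynomial

namespace Summit.Ventures.HSemireg.Wedge.PairPowers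

open Summit.Ventures.HSemireg.Wedge Summit.Ventures.HSemireg.Wedge.Kunneth

variable (K : Type*) [Field K] {m n : ℕ}

/-! ## §1. The kernel dimension in every degree -/

/-- rank–nullity bookkeeping: `rank + dim ker = C((m+m)n, k)` with `rank = [t^k] P_mⁿ` (`m ≥ 1`, `a, c ≠ 0`). -/
theorem coeff_add_finrank_ker_wedge_pairBox (hm : 1 ≤ m) {a c : K} (ha : a ≠ 0) (hc : c ≠ 0) (k : ℕ) :
    (pairPoly m ^ n).coeff k + finrank K (LinearMap.ker (wedge K (Fin ((m + m) * n)) k (pairBox K (m := m) (n := n) a c))) =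
      ((m + m) * n).choose k := by
  have h1 := LinearMap.finrank_range_add_finrank_ker (wedge K (Fin ((m + m) * n)) k (pairBox K (m := m) (n := n) a c))
  rwa [finrank_range_wedge_pairBox_eq_card K hm ha hc, card_Kset hm, exteriorPower.finrank_eq, finrank_fintype_fun_eq_card,
    Fintype.card_fin] at h1

/-- **`dim ker(θ ↦ θ ∧ F ∣ ⋀^k K^{(m+m)n}) = C((m+m)n, k) − [t^k] P_m(t)ⁿ` in EVERY degree `k`**, for every field, `m ≥ 1`, `n`,
`a, c ≠ 0` (gen 6's `finrank_ker_wedge_pairBox` is the case `k < m`). -/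
theorem finrank_ker_wedge_pairBox_every_degree (hm : 1 ≤ m) {a c : K} (ha : a ≠ 0) (hc : c ≠ 0) (k : ℕ) :
    finrank K (LinearMap.ker (wedge K (Fin ((m + m) * n)) k (pairBox K (m := m) (n := n) a c))) =
      ((m + m) * n).choose k - (pairPoly m ^ n).coeff k := by
  have h := coeff_add_finrank_ker_wedge_pairBox K hm ha hc (n := n) k
  omega

/-- the power of th-7's `pairPoly m` cast to `ℤ[X]` has the coefficients of th-6's `P_mⁿ`. -/
theorem coeff_pairPoly_pow_cast (m n k : ℕ) : ((pairPoly m ^ n).coeff k : ℤ) = (FormulaN.Uniform.P m ^ n).coeff k := by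
  have h : (pairPoly m).map (Nat.castRingHom ℤ) = FormulaN.Uniform.P m := by
    ext j
    rw [coeff_map, eq_natCast, coeff_pairPoly_cast]
  rw [← h, ← Polynomial.map_pow, coeff_map, eq_natCast]

/-- … the same dimension in `ℤ` with th-6's `P_m = 2(1+t)^m − 1 − t^m`. -/
theorem finrank_ker_wedge_pairBox_every_degree_cast (hm : 1 ≤ m) {a c : K} (ha : a ≠ 0) (hc : c ≠ 0) (k : ℕ) :
    (finrank K (LinearMap.ker (wedge K (Fin ((m + m) * n)) k (pairBox K (m := m) (n := n) a c))) : ℤ) =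
      (((m + m) * n).choose k : ℤ) - (FormulaN.Uniform.P m ^ n).coeff k := by
  have h := coeff_add_finrank_ker_wedge_pairBox K hm ha hc (n := n) k
  rw [← coeff_pairPoly_pow_cast, ← h, Nat.cast_add]
  ring

/-! ## §2. The volume degree `mn` and the dead degrees above it -/

/-- `pairPoly m` has degree at most `m`. -/
lemma natDegree_pairPoly_le (m : ℕ) : (pairPoly m).natDegree ≤ m := by
  rw [natDegree_le_iff_coeff_eq_zero]
  intro N hN
  rw [coeff_pairPoly, if_neg (by omega)]

/-- its top coefficient: `[t^m] P_m = 2·C(m,m) − [m = 0] − 1 = 1` (`m ≥ 1`). -/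
lemma coeff_pairPoly_self (hm : 1 ≤ m) : (pairPoly m).coeff m = 1 := by
  rw [coeff_pairPoly, if_pos le_rfl, WedgePair.pointPairRank, Nat.choose_self, if_neg (by omega), if_pos rfl]

/-- **`[t^{mn}] P_mⁿ = 1`**: in the volume degree only the product of the top coefficients survives. -/
theorem coeff_pairPoly_pow_self (hm : 1 ≤ m) (n : ℕ) : (pairPoly m ^ n).coeff (m * n) = 1 := by
  rw [mul_comm, coeff_pow_of_natDegree_le (natDegree_pairPoly_le m), coeff_pairPoly_self hm, one_pow]

/-- **rank 1 in the volume degree `mn`**: every degree-`mn` source `θ` has `θ ∧ F` a multiple of the volume form (`m ≥ 1`, `a, c ≠ 0`). -/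
theorem finrank_range_wedge_pairBox_self (hm : 1 ≤ m) {a c : K} (ha : a ≠ 0) (hc : c ≠ 0) :
    finrank K (LinearMap.range (wedge K (Fin ((m + m) * n)) (m * n) (pairBox K (m := m) (n := n) a c))) = 1 := by
  rw [finrank_range_wedge_pairBox_eq_card K hm ha hc, card_Kset hm, coeff_pairPoly_pow_self hm]

/-- … so `dim ker(⋀^{mn}) = C((m+m)n, mn) − 1`. -/
theorem finrank_ker_wedge_pairBox_volume (hm : 1 ≤ m) {a c : K} (ha : a ≠ 0) (hc : c ≠ 0) :
    finrank K (LinearMap.ker (wedge K (Fin ((m + m) * n)) (m * n) (pairBox K (m := m) (n := n) a c))) =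
      ((m + m) * n).choose (m * n) - 1 := by
  rw [finrank_ker_wedge_pairBox_every_degree K hm ha hc, coeff_pairPoly_pow_self hm]

/-- above the volume degree every coefficient of `P_mⁿ` vanishes. -/
lemma coeff_pairPoly_pow_eq_zero_of_lt {k : ℕ} (hk : m * n < k) : (pairPoly m ^ n).coeff k = 0 := by
  apply coeff_eq_zero_of_natDegree_lt
  calc (pairPoly m ^ n).natDegree ≤ n * (pairPoly m).natDegree := natDegree_pow_le
    _ ≤ n * m := Nat.mul_le_mul_left n (natDegree_pairPoly_le m)
    _ < k := by rwa [mul_comm]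

/-- **rank `0` in the dead degrees `k > mn`** … -/
theorem finrank_range_wedge_pairBox_eq_zero_of_lt (hm : 1 ≤ m) {a c : K} (ha : a ≠ 0) (hc : c ≠ 0) {k : ℕ} (hk : m * n < k) :
    finrank K (LinearMap.range (wedge K (Fin ((m + m) * n)) k (pairBox K (m := m) (n := n) a c))) = 0 := by
  rw [finrank_range_wedge_pairBox_eq_card K hm ha hc, card_Kset hm, coeff_pairPoly_pow_eq_zero_of_lt hk]

/-- … where the kernel is all of `⋀^k`: `dim ker = C((m+m)n, k)`. -/
theorem finrank_ker_wedge_pairBox_of_lt (hm : 1 ≤ m) {a c : K} (ha : a ≠ 0) (hc : c ≠ 0) {k : ℕ} (hk : m * n < k) :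
    finrank K (LinearMap.ker (wedge K (Fin ((m + m) * n)) k (pairBox K (m := m) (n := n) a c))) = ((m + m) * n).choose k := by
  rw [finrank_ker_wedge_pairBox_every_degree K hm ha hc, coeff_pairPoly_pow_eq_zero_of_lt hk, Nat.sub_zero]

/-! ## §3. The rank profile is palindromic: `rank_{mn−k} = rank_k` -/

/-- `P_m` is PALINDROMIC of degree `m`: `reflect m P_m = P_m` (`[t^k]P_m = 2C(m,k) − [k=0] − [k=m] = [t^{m−k}]P_m`). -/
theorem reflect_pairPoly (m : ℕ) : (pairPoly m).reflect m = pairPoly m := by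
  ext k
  rw [coeff_reflect, coeff_pairPoly, coeff_pairPoly]
  rcases Nat.lt_or_ge m k with hk | hk
  · rw [revAt_eq_self_of_lt hk, if_neg (by omega)]
  · rw [revAt_le hk, if_pos (Nat.sub_le m k), if_pos hk, WedgePair.pointPairRank, WedgePair.pointPairRank, Nat.choose_symm hk]
    split_ifs <;> omega

/-- so is its `n`-th power: `reflect (mn) P_mⁿ = P_mⁿ`. -/
theorem reflect_pairPoly_pow (m n : ℕ) : (pairPoly m ^ n).reflect (m * n) = pairPoly m ^ n := by
  induction n with
  | zero => rw [pow_zero, mul_zero, reflect_one, pow_zero]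
  | succ n ih =>
    have h1 : (pairPoly m ^ n).natDegree ≤ m * n :=
      calc (pairPoly m ^ n).natDegree ≤ n * (pairPoly m).natDegree := natDegree_pow_le
        _ ≤ n * m := Nat.mul_le_mul_left n (natDegree_pairPoly_le m)
        _ = m * n := mul_comm n m
    rw [pow_succ, mul_add, mul_one, reflect_mul _ _ h1 (natDegree_pairPoly_le m), ih, reflect_pairPoly]

/-- **the RANK PROFILE IS PALINDROMIC: `[t^{mn−k}]P_mⁿ = [t^k]P_mⁿ`**, i.e. `rank(⋀^{mn−k}) = rank(⋀^k)` (`k ≤ mn`). -/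
theorem coeff_pairPoly_pow_symm {k : ℕ} (hk : k ≤ m * n) : (pairPoly m ^ n).coeff (m * n - k) = (pairPoly m ^ n).coeff k := by
  conv_rhs => rw [← reflect_pairPoly_pow m n, coeff_reflect, revAt_le hk]

/-- **`rank(θ ↦ θ ∧ F ∣ ⋀^{mn−k}) = rank(θ ↦ θ ∧ F ∣ ⋀^k)`** for every field, `m ≥ 1`, `n`, `k ≤ mn`, `a, c ≠ 0` (the per-`q`
palindrome at fixed `k` is p10 gen 4's `WedgePointPairPowersPerQSymm`; this is the symmetry in the degree `k`). -/
theorem finrank_range_wedge_pairBox_symm (hm : 1 ≤ m) {a c : K} (ha : a ≠ 0) (hc : c ≠ 0) {k : ℕ} (hk : k ≤ m * n) :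
    finrank K (LinearMap.range (wedge K (Fin ((m + m) * n)) (m * n - k) (pairBox K (m := m) (n := n) a c))) =
      finrank K (LinearMap.range (wedge K (Fin ((m + m) * n)) k (pairBox K (m := m) (n := n) a c))) := by
  rw [finrank_range_wedge_pairBox_eq_card K hm ha hc, finrank_range_wedge_pairBox_eq_card K hm ha hc, card_Kset hm, card_Kset hm,
    coeff_pairPoly_pow_symm hk]

/-! ## §4. Curves and surfaces -/

/-- **CURVES (`m = 1`, the box `Π_i (a·x_i + c·y_i)`): `rank(⋀^k) = C(n,k)` and `dim ker(⋀^k) = C(2n,k) − C(n,k)`** for every field,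
`n`, `k`, `a, c ≠ 0` (in the quoted dictionary the kernel is the degree-`k` part of the ideal generated by the `n` lines
`c·y_i − (±a)·x_i`; cf. `WedgePointPairPowersKernelCollapse` for the names in general `m`). -/
theorem finrank_ker_wedge_pairBox_one {a c : K} (ha : a ≠ 0) (hc : c ≠ 0) (k : ℕ) :
    finrank K (LinearMap.range (wedge K (Fin ((1 + 1) * n)) k (pairBox K (m := 1) (n := n) a c))) = n.choose k ∧
      finrank K (LinearMap.ker (wedge K (Fin ((1 + 1) * n)) k (pairBox K (m := 1) (n := n) a c))) = (2 * n).choose k - n.choose k := by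
  -- `P_1 = 1 + t` (th-6: «b = n − 1: divisor»; the tree statement is `Wedge.DegeneratePair.pairPoly_one`, re-derived locally here)
  have h0 : pairPoly 1 = 1 + X := by
    ext j
    rw [coeff_pairPoly, coeff_add, coeff_one, coeff_X, WedgePair.pointPairRank]
    rcases Nat.lt_or_ge j 2 with hj | hj
    · interval_cases j <;> simp
    · rw [if_neg (by omega), if_neg (by omega), if_neg (by omega), add_zero]
  have h1 : (pairPoly 1 ^ n).coeff k = n.choose k := by rw [h0, add_comm, coeff_X_add_one_pow ℕ n k, Nat.cast_id]
  rw [finrank_range_wedge_pairBox_eq_card K le_rfl ha hc, card_Kset le_rfl, finrank_ker_wedge_pairBox_every_degree K le_rfl ha hc, h1,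
    show (1 + 1) * n = 2 * n by ring]
  exact ⟨by norm_cast, rfl⟩

/-- **SURFACES (`m = 2`) in degree 2: `dim ker = C(4n, 2) − (8n² − 7n) = 5n`** for every field, `n`, `a, c ≠ 0` — STRUCTURE C10's `5n`
in the `PairPowers` model (`pairPoly 2 = surfPoly`, gen 2's `coeff_surfPoly_pow`: `[t²](1+4t+t²)ⁿ = n + 16·C(n,2)`); the NAMES of the
`5n` (the `4n` split pairs and the `n` collapsed lines) are `WedgePointPairPowersKernelCollapse`'s. -/
theorem finrank_ker_wedge_pairBox_two_two {a c : K} (ha : a ≠ 0) (hc : c ≠ 0) :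
    finrank K (LinearMap.ker (wedge K (Fin ((2 + 2) * n)) 2 (pairBox K (m := 2) (n := n) a c))) = 5 * n := by
  have h := coeff_add_finrank_ker_wedge_pairBox K (show 1 ≤ 2 by norm_num) ha hc (n := n) 2
  rw [pairPoly_two_eq_surfPoly, (SurfacePowers.coeff_surfPoly_pow n).2.2.1] at h
  have h2 := (FormulaN.Uniform.plainFamilyARank_eq n).2
  rw [FormulaN.Uniform.plainFamilyARank, FormulaN.Uniform.plainFamilyAKer, FormulaN.Uniform.dimHT,
    show n + n + n + n = (2 + 2) * n by ring] at h2
  omega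

end Summit.Ventures.HSemireg.Wedge.PairPowers
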